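import Literature.MathematicalPhysics.QuantumFieldTheory.Balaban1983to89.B4Eq220CommutatorZeroBox
import Literature.MathematicalPhysics.QuantumFieldTheory.Balaban1983to89.B4PartitionUnity22

/-!
# `Balaban1983to89.B4Eq220PartitionSizes` — [Balaban1983RegularityDecay] p. 577 «|∂^ηh_j| ≤ O(M⁻¹), |Δ^ηh_j| ≤ O(M⁻²)»
ON THE LATTICE for the concrete partition of unity of `B4PartitionUnity22`: the size hypotheses `HSize` of
`B4Eq220CommutatorZeroBox` DISCHARGED, hence the factor bound (2.20) «‖K_{ω_i}G_k(□_{ω_i},Ã_{ω_i})h_{ω_i}‖ ≤ c₂O(1)M⁻¹»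
at zero field on boxes for [B4]'s own `h_j`

statement-level skeleton of published theorems with citation tags; proofs where landed; nothing here is a claim about the Yang–Mills mass gap

CITATION HEADER.  T. Bałaban, *Regularity and decay of lattice Green's functions*, Commun. Math. Phys. **89** (1983)
571–597, doi:10.1007/bf01214744 [Balaban1983RegularityDecay] (cell paper B4; held text
`paper:balaban1983-cmp89-regularity-decay`, journal page = PDF page + 570; pp. 575–578 read from the page renders
`b2b-balaban-ref1/pages/1983-cmp89-regularity-decay/…-p005…p008-x2.png`).  Unit `lit-balaban-r01` gen 5 (B4 fold owner),
HOME `run/shared/lean/pub/lit-balaban/`, SKELETON rows **B4.Eq2.18** ((2.18)–(2.22), the factor bound (2.20)),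
**B4.Eq2.10** (`K_j`) and **B4.Def§2** (`h_j`).  Imports `B4Eq220CommutatorZeroBox` (b04 lineage: `opK`, `HSize`,
`eq220_zero_box_Minv` on the zero-field box family `BoxInst`) and `B4PartitionUnity22` (the concrete profile: `hCube`,
`D1`, `D2`, `abs_hCube_diff_le`, `abs_hCube_second_diff_le`, flatness `hprof_eq_one`/`hprof_eq_zero`).

WHAT IS PRINTED (verbatim).  p. 576, after (2.7): *«where we have used the fact that the normal derivative of h_j to the
boundary of □_j is equal to 0.»*; p. 577: *«In the sequel we will see that R is a small operator in reasonable norms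
because |∂^ηh_j| ≤ O(M⁻¹), |Δ^ηh_j| ≤ O(M⁻²)»*; p. 578: *«We estimate the first sum using Lemma 2.2 by (2.20)
Σ′_{ω:n≤n₀} c₁‖K_{ω₁}G_k(□_{ω₁},Ã_{ω₁})h_{ω₁}‖_∞ · … · ‖K_{ω_n}G_k(□_{ω_n},Ã_{ω_n})h_{ω_n}‖_∞‖f‖_∞ ≤ Σ′_{ω:n≤n₀}
c₁(c₂O(1)M⁻¹)ⁿ‖f‖_∞.»*

WHAT THIS MODULE PROVES (all in full; `d+1` lattice dimensions as everywhere in the lineage; mesh `n = L^k` fine sites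
per unit length; `K` = the print's large-cube size `M`; b04's box `Π_μ[0, nM_μ)` with sides `M_μ` unit blocks).
* `hZ n K j x = hCube K j (x/n)` — **the printed `h_j` on the fine lattice `ℤ^{d+1}`**; `hBox` its restriction to the box.
* §1–§2 folklore: flatness of the profile near the integers (`hprof_int_sub_eq`: `h(z − u) = h(z)`, `z ∈ ℤ`,
  `0 ≤ u ≤ 3/8`), `|Πa − Πb| ≤ Σ|a_i − b_i|` for `[−1,1]`-factors, the coordinatewise Lipschitz bound `abs_hCube_sub_le`,
  positions of lattice neighbours as coordinate updates, the real form of b04's `sum_nbrs`, and «two sites of one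
  unit block differ by less than one unit length».
* §3 THE THREE SIZES of `B4Eq220CommutatorZeroBox.HSize` for `hBox`:
  `grad_hZ_le` — **«|∂^ηh_j| ≤ O(M⁻¹)»**: `n|h_j(x ± e_i) − h_j(x)| ≤ D1(h)/K`;
  `secondDiff_hZ_le` — `|h_j(x+e_i) − 2h_j(x) + h_j(x−e_i)| ≤ D2(h)n⁻²/K²`;
  `hZ_sub_single_eq_of_low_face` / `hZ_add_single_eq_of_high_face` — **the normal-derivative remark**: at a face of a box
  whose sides are multiples of `K` the phantom neighbour carries the same value (`nK ≥ 3`), hence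
  `neumann_sum_hBox_eq` — THE NEUMANN LAPLACIAN OF `h_j` ON THE BOX IS ITS FULL LAPLACIAN — and `lap_hBox_le` —
  **«|Δ^ηh_j| ≤ O(M⁻²)»**: `|n²Σ_{y∼x, y∈□}(h_j(y) − h_j(x))| ≤ (d+1)D2(h)/K²`;
  `osc_hBox_le` — block oscillation `|h_j(x) − h_j(y)| ≤ (d+1)D1(h)/K` within a unit block;
  **`hsize_hBox`** — `HSize n M h_j (c/K) (c/K²) (c/K)` with `c = (d+1)(D1(h) + D2(h))`, for `n, K ≥ 1`, `nK ≥ 3`,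
  `K ∣ M_μ`.
* §4 **`eq220_hBox`** — the factor bound (2.20) of `B4Eq220CommutatorZeroBox.eq220_zero_box_Minv` with its size
  hypotheses DISCHARGED: ONE `C > 0` such that for every member of the zero-field box family `BoxInst d ℓ m²₊`, every
  `K ≥ 2` dividing the box sides, every label `j`, every exponent pair on the printed parallelogram (`p₁ > d+1`) and
  every `f`: `‖K_{h_j}G_k(□,0)(h_jf)‖_{1/t} ≤ C·(2(d+1) + 1 + a)·c·K⁻¹·‖f‖_{1/s}` — «c₂O(1)M⁻¹» for [B4]'s own partition of
  unity.

HONEST SCOPE.  Zero field (`Ã = 0`), boxes (b04's `BoxInst`), box sides multiples of the large-cube size `K` (print: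
`Ω`, `□_j` are unions of `M`-blocks); constants through `D1 = sup|h′|`, `D2 = sup|h″|` of the concrete profile (no
numerals); nothing of (2.12)–(2.13), (2.18)–(2.19), (2.21)–(2.22) is summed here (`B4RandomWalk213`, `B4LpChain221`).
Two plumbing `def`s (`hZ`, `hBox`), no `Prop` fact, no `sorry`; axioms standard.
-/

namespace Literature.MathematicalPhysics.QuantumFieldTheory.Balaban1983to89.B4Eq220PartitionSizes

open Finset Matrix
open Literature.MathematicalPhysics.QuantumFieldTheory.Balaban1983to89.B4Reflection242 (boxDom mem_boxDom nbrs mem_nbrs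
  blk)
open Literature.MathematicalPhysics.QuantumFieldTheory.Balaban1983to89.B4Green242Bridge (boxNbrs boxBlk)
open Literature.MathematicalPhysics.QuantumFieldTheory.Balaban1983to89.B4Eq220CommutatorZeroBox (HSize mem_boxNbrs_iff
  opK eq220_zero_box_Minv)
open Literature.MathematicalPhysics.QuantumFieldTheory.Balaban1983to89.B4Ineq19ZeroBoxEta (BoxInst)
open Literature.MathematicalPhysics.QuantumFieldTheory.Balaban1983to89.B4Lemma22ZeroBoxCube (toZFC)
open Literature.MathematicalPhysics.QuantumFieldTheory.Balaban1983to89.B4PartitionUnity22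

noncomputable section

variable {d : ℕ}

/-! ## §1. Real-variable facts about the profile: flatness near the integers, Lipschitz products -/

/-- FLATNESS OF `h` NEAR THE INTEGERS: `h(z − u) = h(z)` for `z ∈ ℤ`, `0 ≤ u ≤ 3/8` (`h = 1` on `[−3/8, 3/8]`, `h = 0` on
`|t| ≥ 5/8`) — the real-variable content of «the normal derivative of h_j to the boundary of □_j is equal to 0»
(p. 576; the faces of `□_j` lie on the `M`-lattice). [cite: Balaban1983RegularityDecay, (2.7) p.576] -/
theorem hprof_int_sub_eq (z : ℤ) {u : ℝ} (hu0 : 0 ≤ u) (hu : u ≤ 3 / 8) : hprof (z - u) = hprof z := by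
  rcases lt_trichotomy z 0 with hz | hz | hz
  · have hz' : (z : ℝ) ≤ -1 := by exact_mod_cast Int.le_sub_one_of_lt hz
    rw [hprof_eq_zero (t := (z : ℝ) - u) (by rw [abs_of_neg (by linarith)]; linarith),
      hprof_eq_zero (t := (z : ℝ)) (by rw [abs_of_neg (by linarith)]; linarith)]
  · subst hz
    push_cast
    rw [zero_sub, hprof_neg, hprof_eq_one (by rw [abs_of_nonneg hu0]; exact hu),
      hprof_eq_one (by rw [abs_zero]; norm_num)]
  · have hz' : (1 : ℝ) ≤ z := by exact_mod_cast hz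
    rw [hprof_eq_zero (t := (z : ℝ) - u) (by rw [abs_of_pos (by linarith)]; linarith),
      hprof_eq_zero (t := (z : ℝ)) (by rw [abs_of_pos (by linarith)]; linarith)]

/-- products of `[−1, 1]`-bounded reals are `1`-Lipschitz in each factor: `|Π a − Π b| ≤ Σ |a_i − b_i|`. [folklore] -/
private theorem abs_prod_sub_prod_le {ι : Type*} (s : Finset ι) (a b : ι → ℝ) (ha : ∀ i, |a i| ≤ 1)
    (hb : ∀ i, |b i| ≤ 1) : |∏ i ∈ s, a i - ∏ i ∈ s, b i| ≤ ∑ i ∈ s, |a i - b i| := by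
  classical
  induction s using Finset.induction_on with
  | empty => simp
  | insert i s hi ih =>
    rw [Finset.prod_insert hi, Finset.prod_insert hi, Finset.sum_insert hi]
    have hPb : |∏ k ∈ s, b k| ≤ 1 := by
      rw [Finset.abs_prod]
      exact Finset.prod_le_one (fun _ _ => abs_nonneg _) fun k _ => hb k
    calc |a i * ∏ k ∈ s, a k - b i * ∏ k ∈ s, b k|
        = |a i * (∏ k ∈ s, a k - ∏ k ∈ s, b k) + (a i - b i) * ∏ k ∈ s, b k| := by ring_nf
      _ ≤ |a i * (∏ k ∈ s, a k - ∏ k ∈ s, b k)| + |(a i - b i) * ∏ k ∈ s, b k| := abs_add_le _ _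
      _ = |a i| * |∏ k ∈ s, a k - ∏ k ∈ s, b k| + |a i - b i| * |∏ k ∈ s, b k| := by rw [abs_mul, abs_mul]
      _ ≤ 1 * |∏ k ∈ s, a k - ∏ k ∈ s, b k| + |a i - b i| * 1 :=
          add_le_add (mul_le_mul_of_nonneg_right (ha i) (abs_nonneg _))
            (mul_le_mul_of_nonneg_left hPb (abs_nonneg _))
      _ ≤ |a i - b i| + ∑ k ∈ s, |a k - b k| := by linarith

/-- OSCILLATION OF `h_j`: `|h_j(p) − h_j(p′)| ≤ (D1(h)/M)·Σ_μ|p_μ − p′_μ|` (coordinatewise mean-value bound).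
[cite: Balaban1983RegularityDecay, §2 p.577] -/
theorem abs_hCube_sub_le {ι : Type*} [Fintype ι] {M : ℝ} (hM : 0 < M) (j : ι → ℤ) (p p' : ι → ℝ) :
    |hCube M j p - hCube M j p'| ≤ D1 hprof / M * ∑ μ, |p μ - p' μ| := by
  unfold hCube
  refine (abs_prod_sub_prod_le Finset.univ _ _ (fun μ => ?_) (fun μ => ?_)).trans ?_
  · rw [abs_of_nonneg (hprof_nonneg _)]; exact hprof_le_one _
  · rw [abs_of_nonneg (hprof_nonneg _)]; exact hprof_le_one _
  · rw [Finset.mul_sum]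
    refine Finset.sum_le_sum fun μ _ => ?_
    have h := abs_sub_le_D1 contDiff_hprof hasCompactSupport_hprof (p' μ / M - j μ) (p μ / M - j μ)
    rw [show p μ / M - (j μ : ℝ) - (p' μ / M - j μ) = (p μ - p' μ) / M by ring, abs_div, abs_of_pos hM] at h
    calc |hprof (p μ / M - j μ) - hprof (p' μ / M - j μ)| ≤ D1 hprof * (|p μ - p' μ| / M) := h
      _ = D1 hprof / M * |p μ - p' μ| := by ring

/-! ## §2. Lattice geometry: positions of fine sites, neighbours, blocks, faces of the box -/

/-- the position (unit-lattice coordinates) of the fine site `x ∈ ℤ^{d+1}` at mesh `n`: `x/n`. Moving to the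
neighbour `x ± e_i` updates one coordinate by `±1/n`. [folklore] -/
private theorem pos_add_single (n : ℕ) (x : Fin (d + 1) → ℤ) (i : Fin (d + 1)) (c : ℤ) :
    (fun μ => (((x + Pi.single i c : Fin (d + 1) → ℤ) μ : ℤ) : ℝ) / n)
      = Function.update (fun μ => ((x μ : ℤ) : ℝ) / n) i (((x i : ℤ) : ℝ) / n + (c : ℝ) / n) := by
  funext μ
  by_cases hμ : μ = i
  · subst hμ
    rw [Function.update_self, Pi.add_apply, Pi.single_eq_same]
    push_cast
    ring
  · rw [Function.update_of_ne hμ, Pi.add_apply, Pi.single_eq_of_ne hμ, add_zero]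

/-- the position of the backward neighbour `x − e_i`: coordinate `i` updated by `−1/n`. [folklore] -/
private theorem pos_sub_single (n : ℕ) (x : Fin (d + 1) → ℤ) (i : Fin (d + 1)) :
    (fun μ => (((x - Pi.single i 1 : Fin (d + 1) → ℤ) μ : ℤ) : ℝ) / n)
      = Function.update (fun μ => ((x μ : ℤ) : ℝ) / n) i (((x i : ℤ) : ℝ) / n - (1 : ℝ) / n) := by
  rw [show x - Pi.single i (1 : ℤ) = x + Pi.single i (-1) by
    rw [sub_eq_add_neg, ← Pi.single_neg], pos_add_single]
  congr 1
  push_cast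
  ring

/-- the sum over the nearest neighbours, real-valued: `Σ_{z ∈ nbrs x} φ z = Σ_μ φ(x + e_μ) + Σ_μ φ(x − e_μ)`. [folklore] -/
private theorem sum_nbrs_real (φ : (Fin (d + 1) → ℤ) → ℝ) (x : Fin (d + 1) → ℤ) :
    ∑ z ∈ nbrs x, φ z = ∑ μ, φ (x + Pi.single μ 1) + ∑ μ, φ (x - Pi.single μ 1) := by
  have h := B4Green242Bridge.sum_nbrs (fun z => (φ z : ℂ)) x
  exact_mod_cast h

/-- two fine sites of one unit block (`blk n y = blk n x`, i.e. equal integer quotients by `n`) differ by less than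
`n` in every coordinate, i.e. by at most one unit length. [folklore] -/
private theorem abs_sub_div_le_one_of_blk_eq {n : ℕ} (hn : 1 ≤ n) {x y : Fin (d + 1) → ℤ} (h : blk n y = blk n x)
    (μ : Fin (d + 1)) : |((y μ : ℤ) : ℝ) / n - ((x μ : ℤ) : ℝ) / n| ≤ 1 := by
  have hq : y μ / (n : ℤ) = x μ / (n : ℤ) := congrFun h μ
  have hn0 : (0 : ℤ) < n := by exact_mod_cast hn
  have hy := Int.emod_add_mul_ediv (y μ) (n : ℤ)
  have hx := Int.emod_add_mul_ediv (x μ) (n : ℤ)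
  have hy1 := Int.emod_nonneg (y μ) hn0.ne'
  have hy2 := Int.emod_lt_of_pos (y μ) hn0
  have hx1 := Int.emod_nonneg (x μ) hn0.ne'
  have hx2 := Int.emod_lt_of_pos (x μ) hn0
  have hdiff : |y μ - x μ| ≤ n := by
    rw [abs_le]
    constructor <;> nlinarith [hq]
  have hnR : (0 : ℝ) < n := by exact_mod_cast hn0
  rw [← sub_div, abs_div, abs_of_pos hnR, div_le_one hnR]
  exact_mod_cast hdiff

/-! ## §3. The concrete partition function on b04's boxes and its three sizes -/

/-- **the concrete partition function `h_j` on the fine lattice `ℤ^{d+1}` at mesh `n = L^k`** (large-cube size `K` = the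
print's `M`, label `j ∈ Z^{d+1}`): `h_j` of p. 575 evaluated at the position `x/n` (unit-lattice coordinates).
[cite: Balaban1983RegularityDecay, §2 p.575] -/
def hZ (n K : ℕ) (j : Fin (d + 1) → ℤ) (x : Fin (d + 1) → ℤ) : ℝ :=
  hCube (K : ℝ) j (fun μ => ((x μ : ℤ) : ℝ) / n)

/-- the same restricted to b04's box `Π_μ[0, nM_μ)` (`B4Reflection242.boxDom`), the carrier of
`B4Eq220CommutatorZeroBox.opK`/`HSize`. [cite: Balaban1983RegularityDecay, §2 p.575] -/
def hBox (n K : ℕ) (M : Fin (d + 1) → ℕ) (j : Fin (d + 1) → ℤ) (x : ↥(boxDom fun μ => n * M μ)) : ℝ :=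
  hZ n K j x.1

/-- `0 ≤ h_j ≤ 1` on the fine lattice. [cite: Balaban1983RegularityDecay, §2 p.575] -/
theorem hZ_mem_Icc (n K : ℕ) (j : Fin (d + 1) → ℤ) (x : Fin (d + 1) → ℤ) : hZ n K j x ∈ Set.Icc (0 : ℝ) 1 :=
  ⟨hCube_nonneg _ _ _, hCube_le_one _ _ _⟩

/-- split of the product at one coordinate. [folklore] -/
private theorem hCube_split {ι : Type*} [Fintype ι] [DecidableEq ι] (Mr : ℝ) (j : ι → ℤ) (p : ι → ℝ) (i : ι) :
    hCube Mr j p = hprof (p i / Mr - j i) * ∏ ν ∈ Finset.univ.erase i, hprof (p ν / Mr - j ν) :=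
  (Finset.mul_prod_erase Finset.univ _ (Finset.mem_univ i)).symm

/-- the product at an updated point. [folklore] -/
private theorem hCube_update {ι : Type*} [Fintype ι] [DecidableEq ι] (Mr : ℝ) (j : ι → ℤ) (p : ι → ℝ) (i : ι)
    (v : ℝ) : hCube Mr j (Function.update p i v)
      = hprof (v / Mr - j i) * ∏ ν ∈ Finset.univ.erase i, hprof (p ν / Mr - j ν) := by
  unfold hCube
  rw [← Finset.mul_prod_erase Finset.univ _ (Finset.mem_univ i), Function.update_self]
  congr 1
  refine Finset.prod_congr rfl fun ν hν => ?_
  rw [Function.update_of_ne (Finset.ne_of_mem_erase hν)]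

/-- **SIZE 1, «|∂^ηh_j| ≤ O(M⁻¹)»** on the fine lattice: `n·|h_j(x ± e_i) − h_j(x)| ≤ D1(h)/K` (one `η`-bond, `η = 1/n`,
against a profile varying on scale `K`). [cite: Balaban1983RegularityDecay, §2 p.577] -/
theorem grad_hZ_le {n K : ℕ} (hn : 1 ≤ n) (hK : 1 ≤ K) (j : Fin (d + 1) → ℤ) (x : Fin (d + 1) → ℤ)
    (i : Fin (d + 1)) :
    (n : ℝ) * |hZ n K j (x + Pi.single i 1) - hZ n K j x| ≤ D1 hprof / K ∧
      (n : ℝ) * |hZ n K j (x - Pi.single i 1) - hZ n K j x| ≤ D1 hprof / K := by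
  have hKr : (0 : ℝ) < K := by exact_mod_cast hK
  have hnr : (0 : ℝ) < n := by exact_mod_cast hn
  have key : ∀ η : ℝ, |η| = 1 / n →
      (n : ℝ) * |hCube (K : ℝ) j (Function.update (fun μ => ((x μ : ℤ) : ℝ) / n) i
        (((x i : ℤ) : ℝ) / n + η)) - hCube (K : ℝ) j (fun μ => ((x μ : ℤ) : ℝ) / n)| ≤ D1 hprof / K := by
    intro η hη
    have h := abs_hCube_diff_le hKr j (fun μ => ((x μ : ℤ) : ℝ) / n) i η
    rw [hη] at h
    calc (n : ℝ) * _ ≤ (n : ℝ) * (D1 hprof * (1 / n) / K) := mul_le_mul_of_nonneg_left h hnr.le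
      _ = D1 hprof / K := by field_simp
  constructor
  · unfold hZ
    rw [pos_add_single]
    push_cast
    exact key _ (by rw [abs_of_pos (by positivity)])
  · unfold hZ
    rw [pos_sub_single, sub_eq_add_neg]
    exact key _ (by rw [abs_neg, abs_of_pos (by positivity)])

/-- **SIZE 2, the second differences**: `|h_j(x + e_i) − 2h_j(x) + h_j(x − e_i)| ≤ D2(h)·n⁻²/K²` on the fine lattice.
[cite: Balaban1983RegularityDecay, §2 p.577] -/
theorem secondDiff_hZ_le {n K : ℕ} (hn : 1 ≤ n) (j : Fin (d + 1) → ℤ) (x : Fin (d + 1) → ℤ)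
    (i : Fin (d + 1)) :
    |hZ n K j (x + Pi.single i 1) - 2 * hZ n K j x + hZ n K j (x - Pi.single i 1)|
      ≤ D2 hprof * (1 / (n : ℝ)) ^ 2 / (K : ℝ) ^ 2 := by
  have hnr : (0 : ℝ) < n := by exact_mod_cast hn
  unfold hZ
  rw [pos_add_single, pos_sub_single]
  push_cast
  exact abs_hCube_second_diff_le (K : ℝ) j (fun μ => ((x μ : ℤ) : ℝ) / n) i (1 / n)

/-- **FLATNESS AT THE FACES** («the normal derivative of h_j to the boundary of □_j is equal to 0», p. 576): at a
LOW face `x_i = 0` of a box whose sides are multiples of the large-cube size `K` (mesh `n`, `nK ≥ 3`), the phantom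
neighbour `x − e_i` carries the same value of `h_j`. [cite: Balaban1983RegularityDecay, (2.7) p.576] -/
theorem hZ_sub_single_eq_of_low_face {n K : ℕ} (hn : 1 ≤ n) (hnK : 3 ≤ n * K) (j : Fin (d + 1) → ℤ)
    {x : Fin (d + 1) → ℤ} {i : Fin (d + 1)} (hx : x i = 0) :
    hZ n K j (x - Pi.single i 1) = hZ n K j x := by
  have hnr : (0 : ℝ) < n := by exact_mod_cast hn
  have hK1 : 1 ≤ K := by
    rcases Nat.eq_zero_or_pos K with h0 | h0
    · subst h0; simp at hnK
    · exact h0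
  have hKr : (0 : ℝ) < K := by exact_mod_cast hK1
  have hnKr : (3 : ℝ) ≤ (n : ℝ) * K := by exact_mod_cast hnK
  unfold hZ
  rw [pos_sub_single, hCube_update, hCube_split (K : ℝ) j _ i]
  congr 1
  rw [hx]
  push_cast
  rw [zero_div, zero_sub, zero_div, zero_sub, show -(1 / (n : ℝ)) / (K : ℝ) - (j i : ℝ) = ((-j i : ℤ) : ℝ) - 1 / ((n : ℝ) * K) by
    push_cast; field_simp; ring, show -((j i : ℤ) : ℝ) = ((-j i : ℤ) : ℝ) by push_cast; ring]
  apply hprof_int_sub_eq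
  · positivity
  · rw [div_le_iff₀ (by positivity)]
    linarith

/-- FLATNESS at a HIGH face `x_i = nM_i − 1` (with `K ∣ M_i`, `nK ≥ 3`): the phantom neighbour `x + e_i` carries the
same value of `h_j`. [cite: Balaban1983RegularityDecay, (2.7) p.576] -/
theorem hZ_add_single_eq_of_high_face {n K : ℕ} (hn : 1 ≤ n) (hnK : 3 ≤ n * K) {M : Fin (d + 1) → ℕ}
    (j : Fin (d + 1) → ℤ) {x : Fin (d + 1) → ℤ} {i : Fin (d + 1)} (hKM : K ∣ M i)
    (hx : x i = (n : ℤ) * M i - 1) :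
    hZ n K j (x + Pi.single i 1) = hZ n K j x := by
  have hnr : (0 : ℝ) < n := by exact_mod_cast hn
  have hK1 : 1 ≤ K := by
    rcases Nat.eq_zero_or_pos K with h0 | h0
    · subst h0; simp at hnK
    · exact h0
  have hKr : (0 : ℝ) < K := by exact_mod_cast hK1
  have hnKr : (3 : ℝ) ≤ (n : ℝ) * K := by exact_mod_cast hnK
  obtain ⟨m, hm⟩ := hKM
  unfold hZ
  rw [pos_add_single, hCube_update, hCube_split (K : ℝ) j _ i]
  congr 1
  rw [hx, hm]
  push_cast
  have e1 : (((n : ℝ) * ((K : ℝ) * m) - 1) / n + (1 : ℝ) / n) / K - (j i : ℝ) = (((m : ℤ) - j i : ℤ) : ℝ) := by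
    push_cast; field_simp; ring
  have e2 : ((n : ℝ) * ((K : ℝ) * m) - 1) / n / K - (j i : ℝ) = (((m : ℤ) - j i : ℤ) : ℝ) - 1 / ((n : ℝ) * K) := by
    push_cast; field_simp; ring
  rw [e1, e2, hprof_int_sub_eq]
  · positivity
  · rw [div_le_iff₀ (by positivity)]
    linarith

/-- **THE NEUMANN LAPLACIAN OF `h_j` IS ITS FULL LAPLACIAN** on a box `Π_μ[0, nM_μ)` whose sides are multiples of `K`:
`Σ_{y ∼ x, y ∈ □}(h_j(y) − h_j(x)) = Σ_μ (h_j(x + e_μ) − 2h_j(x) + h_j(x − e_μ))` — the missing neighbours at the faces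
contribute nothing by flatness. [cite: Balaban1983RegularityDecay, (2.7) p.576] -/
theorem neumann_sum_hBox_eq {n K : ℕ} (hn : 1 ≤ n) (hnK : 3 ≤ n * K) {M : Fin (d + 1) → ℕ}
    (hKM : ∀ μ, K ∣ M μ) (j : Fin (d + 1) → ℤ) (x : ↥(boxDom fun μ => n * M μ)) :
    ∑ y ∈ boxNbrs (fun μ => n * M μ) x, (hBox n K M j y - hBox n K M j x)
      = ∑ μ, (hZ n K j (x.1 + Pi.single μ 1) - 2 * hZ n K j x.1 + hZ n K j (x.1 - Pi.single μ 1)) := by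
  classical
  have hx : ∀ i, 0 ≤ x.1 i ∧ x.1 i < (n : ℤ) * (M i : ℤ) := by
    intro i
    have h := (mem_boxDom.mp x.2) i
    push_cast at h
    exact h
  -- Step 1: the box-neighbour sum as a sum over the lattice neighbours lying in the box
  have h1 : ∑ y ∈ boxNbrs (fun μ => n * M μ) x, (hBox n K M j y - hBox n K M j x)
      = ∑ z ∈ (nbrs x.1).filter (fun z => z ∈ boxDom (fun μ => n * M μ)), (hZ n K j z - hZ n K j x.1) := by
    have hA : ∑ y ∈ boxNbrs (fun μ => n * M μ) x, (hBox n K M j y - hBox n K M j x)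
        = ∑ y : ↥(boxDom fun μ => n * M μ), (if y.1 ∈ nbrs x.1 then hBox n K M j y - hBox n K M j x else 0) := by
      rw [show boxNbrs (fun μ => n * M μ) x = Finset.univ.filter (fun y => y.1 ∈ nbrs x.1) from rfl,
        Finset.sum_filter]
    have hB : ∑ y : ↥(boxDom fun μ => n * M μ), (if y.1 ∈ nbrs x.1 then hBox n K M j y - hBox n K M j x else 0)
        = ∑ z ∈ boxDom (fun μ => n * M μ), (if z ∈ nbrs x.1 then hZ n K j z - hZ n K j x.1 else 0) :=
      (Finset.sum_subtype (boxDom fun μ => n * M μ) (fun _ => Iff.rfl)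
        (fun z => if z ∈ nbrs x.1 then hZ n K j z - hZ n K j x.1 else 0)).symm
    have hD : (boxDom (fun μ => n * M μ)).filter (fun z => z ∈ nbrs x.1)
        = (nbrs x.1).filter (fun z => z ∈ boxDom (fun μ => n * M μ)) := by
      ext z
      simp only [Finset.mem_filter]
      exact and_comm
    rw [hA, hB, ← Finset.sum_filter, hD]
  -- Step 2: the neighbours outside the box contribute zero (flatness at the faces)
  have h2 : ∑ z ∈ (nbrs x.1).filter (fun z => z ∈ boxDom (fun μ => n * M μ)), (hZ n K j z - hZ n K j x.1)
      = ∑ z ∈ nbrs x.1, (hZ n K j z - hZ n K j x.1) := by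
    apply Finset.sum_subset (Finset.filter_subset _ _)
    intro z hz hzN
    rw [Finset.mem_filter, not_and] at hzN
    have hout : z ∉ boxDom (fun μ => n * M μ) := hzN hz
    obtain ⟨i, hzi | hzi⟩ := mem_nbrs.mp hz
    · -- `z = x + e_i` outside the box: `x` sits on the high face `x_i = nM_i − 1`
      have hface : x.1 i = (n : ℤ) * M i - 1 := by
        by_contra hc
        apply hout
        rw [mem_boxDom]
        intro μ
        rw [hzi]
        push_cast
        by_cases hμ : μ = i
        · subst hμ
          rw [Pi.add_apply, Pi.single_eq_same]
          have := hx μ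
          omega
        · rw [Pi.add_apply, Pi.single_eq_of_ne hμ, add_zero]
          exact hx μ
      rw [hzi, hZ_add_single_eq_of_high_face hn hnK j (hKM i) hface, sub_self]
    · -- `z = x − e_i` outside the box: `x` sits on the low face `x_i = 0`
      have hface : x.1 i = 0 := by
        by_contra hc
        apply hout
        rw [mem_boxDom]
        intro μ
        rw [hzi]
        push_cast
        by_cases hμ : μ = i
        · subst hμ
          rw [Pi.sub_apply, Pi.single_eq_same]
          have := hx μ
          omega
        · rw [Pi.sub_apply, Pi.single_eq_of_ne hμ, sub_zero]
          exact hx μ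
      rw [hzi, hZ_sub_single_eq_of_low_face hn hnK j hface, sub_self]
  -- Step 3: split the full neighbour sum into the `2(d+1)` directions
  rw [h1, h2, sum_nbrs_real, ← Finset.sum_add_distrib]
  refine Finset.sum_congr rfl fun μ _ => ?_
  ring

/-- **SIZE 2, «|Δ^ηh_j| ≤ O(M⁻²)»** for the NEUMANN Laplacian of the box: `|n²Σ_{y ∼ x, y ∈ □}(h_j(y) − h_j(x))| ≤
(d+1)·D2(h)/K²`. [cite: Balaban1983RegularityDecay, §2 p.577] -/
theorem lap_hBox_le {n K : ℕ} (hn : 1 ≤ n) (hnK : 3 ≤ n * K) {M : Fin (d + 1) → ℕ} (hKM : ∀ μ, K ∣ M μ)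
    (j : Fin (d + 1) → ℤ) (x : ↥(boxDom fun μ => n * M μ)) :
    |(n : ℝ) ^ 2 * ∑ y ∈ boxNbrs (fun μ => n * M μ) x, (hBox n K M j y - hBox n K M j x)|
      ≤ ((d : ℝ) + 1) * D2 hprof / (K : ℝ) ^ 2 := by
  have hnr : (0 : ℝ) < n := by exact_mod_cast hn
  rw [neumann_sum_hBox_eq hn hnK hKM j x, abs_mul, abs_of_pos (by positivity)]
  calc (n : ℝ) ^ 2 * |∑ μ, (hZ n K j (x.1 + Pi.single μ 1) - 2 * hZ n K j x.1 + hZ n K j (x.1 - Pi.single μ 1))|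
      ≤ (n : ℝ) ^ 2 * ∑ μ : Fin (d + 1), D2 hprof * (1 / (n : ℝ)) ^ 2 / (K : ℝ) ^ 2 := by
        refine mul_le_mul_of_nonneg_left ((Finset.abs_sum_le_sum_abs _ _).trans
          (Finset.sum_le_sum fun μ _ => secondDiff_hZ_le hn j x.1 μ)) (by positivity)
    _ = ((d : ℝ) + 1) * D2 hprof / (K : ℝ) ^ 2 := by
        rw [Finset.sum_const, Finset.card_univ, Fintype.card_fin, nsmul_eq_mul]
        push_cast
        field_simp

/-- **SIZE 3, the block oscillation**: two fine sites of one unit block are at most one unit apart in every coordinate,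
so `|h_j(x) − h_j(y)| ≤ (d+1)·D1(h)/K` (the telescoped `(∂^ηh_j)(Γ_{x,y,x′})` of (2.8)/(2.10)).
[cite: Balaban1983RegularityDecay, (2.8) p.576] -/
theorem osc_hBox_le {n K : ℕ} (hn : 1 ≤ n) (hK : 1 ≤ K) (M : Fin (d + 1) → ℕ) (j : Fin (d + 1) → ℤ)
    (x : ↥(boxDom fun μ => n * M μ)) (y : ↥(boxDom fun μ => n * M μ)) (hy : y ∈ boxBlk n (fun μ => n * M μ) x) :
    |hBox n K M j x - hBox n K M j y| ≤ ((d : ℝ) + 1) * D1 hprof / K := by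
  have hKr : (0 : ℝ) < K := by exact_mod_cast hK
  have hblk : blk n y.1 = blk n x.1 := (Finset.mem_filter.mp hy).2
  unfold hBox hZ
  refine (abs_hCube_sub_le hKr j _ _).trans ?_
  calc D1 hprof / K * ∑ μ, |((x.1 μ : ℤ) : ℝ) / n - ((y.1 μ : ℤ) : ℝ) / n|
      ≤ D1 hprof / K * ∑ _μ : Fin (d + 1), (1 : ℝ) := by
        refine mul_le_mul_of_nonneg_left (Finset.sum_le_sum fun μ _ => ?_)
          (div_nonneg (D1_nonneg contDiff_hprof hasCompactSupport_hprof) hKr.le)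
        rw [abs_sub_comm]
        exact abs_sub_div_le_one_of_blk_eq hn hblk μ
    _ = ((d : ℝ) + 1) * D1 hprof / K := by
        rw [Finset.sum_const, Finset.card_univ, Fintype.card_fin, nsmul_eq_mul, mul_one]
        push_cast
        ring

/-- **THE SIZE HYPOTHESES `HSize` OF `B4Eq220CommutatorZeroBox` DISCHARGED FOR THE CONCRETE `h_j`**: on every box
`Π_μ[0, nM_μ)` whose sides (in unit blocks) are multiples of the large-cube size `K ≥ 1` (mesh `n ≥ 1`, `nK ≥ 3`), the
printed partition function satisfies `HSize n M h_j (c/K) (c/K²) (c/K)` with the one constant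
`c = (d+1)·(D1(h) + D2(h))` — the print's «|∂^ηh_j| ≤ O(M⁻¹), |Δ^ηh_j| ≤ O(M⁻²)» in the form the factor bound (2.20)
consumes. [cite: Balaban1983RegularityDecay, §2 p.577] -/
theorem hsize_hBox {n K : ℕ} (hn : 1 ≤ n) (hK : 1 ≤ K) (hnK : 3 ≤ n * K) {M : Fin (d + 1) → ℕ}
    (hKM : ∀ μ, K ∣ M μ) (j : Fin (d + 1) → ℤ) :
    HSize n M (hBox n K M j) (((d : ℝ) + 1) * (D1 hprof + D2 hprof) / K)
      (((d : ℝ) + 1) * (D1 hprof + D2 hprof) / (K : ℝ) ^ 2) (((d : ℝ) + 1) * (D1 hprof + D2 hprof) / K) := by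
  have hKr : (0 : ℝ) < K := by exact_mod_cast hK
  have hD1 := D1_nonneg contDiff_hprof hasCompactSupport_hprof
  have hD2 := D2_nonneg contDiff_hprof hasCompactSupport_hprof
  have hd : (1 : ℝ) ≤ (d : ℝ) + 1 := by
    have : (0 : ℝ) ≤ d := Nat.cast_nonneg d
    linarith
  refine ⟨by positivity, by positivity, by positivity, ?_, ?_, ?_, ?_⟩
  · intro x
    simp only [hBox]
    rw [abs_of_nonneg (hZ_mem_Icc n K j x.1).1]
    exact (hZ_mem_Icc n K j x.1).2
  · intro x y hy
    obtain ⟨i, hyi | hyi⟩ := mem_nbrs.mp (mem_boxNbrs_iff.mp hy)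
    · calc (n : ℝ) * |hBox n K M j y - hBox n K M j x| ≤ D1 hprof / K := by
            unfold hBox; rw [hyi]; exact (grad_hZ_le hn hK j x.1 i).1
        _ ≤ ((d : ℝ) + 1) * (D1 hprof + D2 hprof) / K := by
            rw [div_le_div_iff_of_pos_right hKr]; nlinarith
    · calc (n : ℝ) * |hBox n K M j y - hBox n K M j x| ≤ D1 hprof / K := by
            unfold hBox; rw [hyi]; exact (grad_hZ_le hn hK j x.1 i).2
        _ ≤ ((d : ℝ) + 1) * (D1 hprof + D2 hprof) / K := by
            rw [div_le_div_iff_of_pos_right hKr]; nlinarith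
  · intro x
    calc |(n : ℝ) ^ 2 * ∑ y ∈ boxNbrs (fun μ => n * M μ) x, (hBox n K M j y - hBox n K M j x)|
        ≤ ((d : ℝ) + 1) * D2 hprof / (K : ℝ) ^ 2 := lap_hBox_le hn hnK hKM j x
      _ ≤ ((d : ℝ) + 1) * (D1 hprof + D2 hprof) / (K : ℝ) ^ 2 := by
          rw [div_le_div_iff_of_pos_right (by positivity)]; nlinarith
  · intro x y hy
    calc |hBox n K M j x - hBox n K M j y| ≤ ((d : ℝ) + 1) * D1 hprof / K := osc_hBox_le hn hK M j x y hy
      _ ≤ ((d : ℝ) + 1) * (D1 hprof + D2 hprof) / K := by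
          rw [div_le_div_iff_of_pos_right hKr]; nlinarith

/-! ## §4. The printed factor bound (2.20) «‖K_{ω_i}G_k(□_{ω_i},Ã_{ω_i})h_{ω_i}‖ ≤ c₂O(1)M⁻¹» for the concrete `h_j`,
zero field, boxes -/

/-- **(2.20) FOR THE CONCRETE PARTITION OF UNITY, ZERO FIELD, BOXES**: there is ONE constant `C > 0` such that for
every member `i` of the lineage's zero-field box family (scale `k ≥ 1`, mesh `n = L^k`, box sides `M_μ` unit blocks,
mass `m² ∈ [0, m²₊]`), every large-cube size `K ≥ 2` dividing the box sides, every label `j`, every pair of exponents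
on the printed parallelogram and every `f`:
`‖K_{h_j}G_k(□,0)(h_jf)‖_{1/t} ≤ C·(2(d+1) + 1 + a)·c·K⁻¹·‖f‖_{1/s}`, `c = (d+1)(D1(h) + D2(h))` — the shape
`c₂O(1)M⁻¹` of «c₁(c₂O(1)M⁻¹)ⁿ», by `B4Eq220CommutatorZeroBox.eq220_zero_box_Minv` with its size hypotheses now
DISCHARGED (`hsize_hBox`). [cite: Balaban1983RegularityDecay, (2.20) p.578] -/
theorem eq220_hBox {ℓ : ℕ} {m2plus : ℝ} (hℓ : 1 ≤ ℓ) (a : ℝ) (ha : 0 < a) (p₁ : ℝ) (hp : (d : ℝ) + 1 < p₁) :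
    ∃ C : ℝ, 0 < C ∧ ∀ (i : BoxInst d ℓ m2plus) (K : ℕ) (j : Fin (d + 1) → ℤ), 2 ≤ K → (∀ μ, K ∣ i.M μ) →
      ∀ s t : ℝ, 0 ≤ t → s ≤ 1 → s - 1 / p₁ ≤ t → t ≤ s →
      ∀ f : ↥(boxDom fun μ => (ℓ + 1) ^ i.k * i.M μ) → ℝ,
        (toZFC i).lpN t (opK ((ℓ + 1) ^ i.k) a i.m2 i.M (hBox ((ℓ + 1) ^ i.k) K i.M j)
            ((toZFC i).green a *ᵥ fun y => hBox ((ℓ + 1) ^ i.k) K i.M j y * f y))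
          ≤ C * ((2 * ((d : ℝ) + 1) + 1 + a) * (((d : ℝ) + 1) * (D1 hprof + D2 hprof)) / K)
            * (toZFC i).lpN s f := by
  obtain ⟨C, hC, hK⟩ := eq220_zero_box_Minv (d := d) (m2plus := m2plus) hℓ a ha p₁ hp
  refine ⟨C, hC, fun i K j hK2 hKM s t ht0 hs1 hst hts f => ?_⟩
  have hn : 1 ≤ (ℓ + 1) ^ i.k := Nat.one_le_pow _ _ (Nat.succ_pos ℓ)
  have hn2 : 2 ≤ (ℓ + 1) ^ i.k := by
    calc 2 ≤ ℓ + 1 := by omega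
      _ = (ℓ + 1) ^ 1 := (pow_one _).symm
      _ ≤ (ℓ + 1) ^ i.k := Nat.pow_le_pow_right (Nat.succ_pos ℓ) i.hk
  have hnK : 3 ≤ (ℓ + 1) ^ i.k * K := by nlinarith
  have hc : 0 ≤ ((d : ℝ) + 1) * (D1 hprof + D2 hprof) := by
    have := D1_nonneg contDiff_hprof hasCompactSupport_hprof
    have := D2_nonneg contDiff_hprof hasCompactSupport_hprof
    positivity
  have hKr : (1 : ℝ) ≤ K := by exact_mod_cast (le_trans (by norm_num) hK2 : 1 ≤ K)
  exact hK i _ _ hc hKr _ (hsize_hBox hn (le_trans (by norm_num) hK2) hnK hKM j) s t ht0 hs1 hst hts f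

end

end Literature.MathematicalPhysics.QuantumFieldTheory.Balaban1983to89.B4Eq220PartitionSizes
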